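import Summits.BirchSwinnertonDyer.BirchSwinnertonDyer.Theorems.ClassRecordThreeEulerHalvesAtThreeResidualUpperBoundCartanEmptyDegreeIndepTransport
import HarnessLib

/-!
# Crux NUM `CartanOnePlaceDegreeLawAtThree` (item 24801), line `lattice` — towards the discharge of the print fact (ISO) `cartanParametrizationData_deg_of_periods_mul`:
# a non-zero weight-two form on a COCOMPACT properly discontinuous group has a DEGREE (generic-group form of `ShimuraCurveData.exists_deg_of_hasPeriodsIn`)

Seat `bsd-stepL-tam3-p1` g27 (LEAD of crux 24801; `--supports stmt-BirchSwinnertonDyer-24801 --as helper`). The tree theorem `ShimuraCurveData.exists_deg_of_hasPeriodsIn`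
(`Literature/NumberTheory/Automorphic/ShimuraCurveMapDegreeProofs.lean`, Farkas–Kra Prop. I.1.6 on `Γ₀^D(M)∖ℍ`, `D > 1`) uses of the datum `X` only two facts: proper discontinuity of
`X.Gamma` on `ℍ` and cocompactness (one closed ball meeting every orbit). This file records the SAME theorem for an ARBITRARY subgroup `Γ ≤ SL₂(ℝ)` under exactly these two
hypotheses (`exists_deg_of_hasPeriodsIn_of_cocompact`; proof ported verbatim), so that it applies to the Cartan-level groups `X.Gamma` of `CartanLevelCurveData D M C` (`D > 1`) and
to the split∕non-split level groups of the cover — the analytic input of (ISO) for `D > 1`. Nothing about NUM or any curve is proved; BSD is proved for no curve.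
-- adapted from Literature/NumberTheory/Automorphic/ShimuraCurveMapDegreeProofs.lean (`ShimuraCurveData.exists_deg_of_hasPeriodsIn`, X.Gamma ↦ Γ)
[cite: FarkasKra1992, Prop. I.1.6] [cite: PastenShimura2024, Prop. 5.1 p. 17 (proof)]
-/

set_option linter.dupNamespace false
set_option autoImplicit false

noncomputable section

open scoped MatrixGroups ModularForm Topology
open UpperHalfPlane Filter Set Function

namespace Summit.BirchSwinnertonDyer.BirchSwinnertonDyer.Theorems.CartanCover.MapDegree

open Literature.NumberTheory.Automorphic
open Literature.NumberTheory.EllipticCurves.ModularForms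
  (finite_inter_of_forall_exists_nhds_eq finite_zeros_inter_of_isCompact finite_fiber_inter exists_injOn_and_nhds_le_map)

/-- **A non-zero weight-two form with periods in a lattice, on a cocompact properly discontinuous `Γ ≤ SL₂(ℝ)`, has a degree**: there is `d ≥ 1` such that for all but
finitely many classes `c ∈ ℂ∕Λ_L` exactly `d` orbits `Γτ` satisfy `∫_{τ₀}^τ h ≡ c (mod Λ_L)` (Farkas–Kra Prop. I.1.6 for the map `Γ∖ℍ → ℂ∕Λ_L`; the tree's
`ShimuraCurveData.exists_deg_of_hasPeriodsIn` with its two uses of the Shimura datum — proper discontinuity, cocompactness — turned into hypotheses).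
[cite: FarkasKra1992, Prop. I.1.6] -/
theorem exists_deg_of_hasPeriodsIn_of_cocompact {Γ : Subgroup (GL (Fin 2) ℝ)} [Γ.HasDetOne] [ProperlyDiscontinuousSMul Γ ℍ]
    (hcoc : ∃ ρ : ℝ, ∀ τ : ℍ, ∃ γ ∈ Γ, γ • τ ∈ Metric.closedBall UpperHalfPlane.I ρ)
    (h : CuspForm Γ 2) (hh : (⇑h : ℍ → ℂ) ≠ 0)
    (L : PeriodPair) (hper : HasPeriodsIn Γ h (L.lattice : Set ℂ)) (τ₀ : ℍ) :
    ∃ d : ℕ, 0 < d ∧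
      {c : ℂ ⧸ L.lattice.toAddSubgroup |
        Nat.card {y : MulAction.orbitRel.Quotient Γ ℍ // ∃ τ : ℍ,
          (Quotient.mk _ τ : MulAction.orbitRel.Quotient Γ ℍ) = y ∧
            ((segmentIntegral h τ₀ τ : ℂ) : ℂ ⧸ L.lattice.toAddSubgroup) = c} ≠ d}.Finite := by
  classical
  set Ψ : ℍ → ℂ := segmentIntegral h τ₀ with hΨdef
  set Λ : AddSubgroup ℂ := L.lattice.toAddSubgroup with hΛdef
  -- the lattice `Λ` is closed, discrete and countable
  have hΛc : IsClosed (Λ : Set ℂ) := L.isClosed_lattice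
  obtain ⟨r, hr, hrΛ⟩ : ∃ r > 0, ∀ x ∈ Λ, ‖x‖ < r → x = 0 := by
    obtain ⟨ε, hε, hball⟩ := Metric.exists_ball_inter_eq_singleton_of_mem_discrete
      (isDiscrete_iff_discreteTopology.mpr (inferInstance : DiscreteTopology L.lattice))
      (zero_mem L.lattice)
    refine ⟨ε, hε, fun x hx hxn ↦ ?_⟩
    have : x ∈ Metric.ball (0 : ℂ) ε ∩ (L.lattice : Set ℂ) := ⟨by simpa using hxn, hx⟩
    rw [hball] at this
    exact this
  have hΛcount : (Λ : Set ℂ).Countable := by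
    have : Countable L.lattice := Countable.of_equiv _ L.latticeEquivProd.toEquiv.symm
    exact Set.countable_coe_iff.mp this
  -- `Ψ` is `Γ`-equivariant modulo `Λ`, holomorphic with `Ψ' = h`, continuous
  have hΨΓ : ∀ γ ∈ Γ, ∀ τ : ℍ, Ψ (γ • τ) - Ψ τ ∈ Λ := by
    intro γ hγ τ
    rw [hΨdef, segmentIntegral_sub_segmentIntegral h τ₀ τ (γ • τ)]
    exact hper γ hγ τ
  have hderiv : ∀ z : ℂ, 0 < z.im → HasDerivAt (Ψ ∘ ofComplex) (h (ofComplex z)) z :=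
    fun z hz ↦ hasDerivAt_segmentIntegral h τ₀ hz
  have hdiff : DifferentiableOn ℂ (Ψ ∘ ofComplex) {z : ℂ | 0 < z.im} :=
    differentiableOn_segmentIntegral h τ₀
  have hΨc : Continuous Ψ := by
    have h2 : Ψ = (Ψ ∘ ofComplex) ∘ ((↑) : ℍ → ℂ) := by
      funext τ; simp [ofComplex_apply]
    rw [h2]
    exact hdiff.continuousOn.comp_continuous continuous_coe fun τ ↦ τ.im_pos
  -- local inverse at the non-zeros of `h`
  have hloc : ∀ τ : ℍ, h τ ≠ 0 → (∃ U ∈ 𝓝 τ, InjOn Ψ U) ∧ 𝓝 (Ψ τ) ≤ map Ψ (𝓝 τ) := by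
    intro τ hτ
    refine exists_injOn_and_nhds_le_map hdiff (hderiv τ τ.im_pos) ?_
    rwa [ofComplex_apply]
  -- cocompactness: one compact ball `K` meeting every orbit (`D > 1`)
  obtain ⟨ρ, hρ⟩ := hcoc
  set K : Set ℍ := Metric.closedBall UpperHalfPlane.I ρ with hKdef
  have hK : IsCompact K := isCompact_closedBall _ _
  have hKcov : ∀ τ : ℍ, ∃ γ ∈ Γ, γ • τ ∈ K := hρ
  -- the zeros of `h` in `K` and the exceptional set
  have hZfin : ({τ : ℍ | h τ = 0} ∩ K).Finite :=
    finite_zeros_inter_of_isCompact (CuspFormClass.holo h) hh hK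
  set F₁ : Set ℂ := Ψ '' ({τ : ℍ | h τ = 0} ∩ K) with hF₁
  have hF₁fin : F₁.Finite := hZfin.image Ψ
  set S' : Set ℂ := {w | ∃ x ∈ F₁, w - x ∈ Λ} with hS'
  have hS'count : S'.Countable := by
    have : S' = ⋃ x ∈ F₁, (fun l : ℂ ↦ x + l) '' (Λ : Set ℂ) := by
      ext w
      simp only [hS', mem_setOf_eq, mem_iUnion, mem_image, SetLike.mem_coe, exists_prop]
      constructor
      · rintro ⟨x, hx, hw⟩
        exact ⟨x, hx, w - x, hw, by ring⟩
      · rintro ⟨x, hx, l, hl, rfl⟩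
        exact ⟨x, hx, by simpa using hl⟩
    rw [this]
    exact hF₁fin.countable.biUnion fun x _ ↦ hΛcount.image _
  -- local constancy of the orbit count off `S'`
  have hmain : ∀ w₀, w₀ ∉ S' →
      Finite {y : MulAction.orbitRel.Quotient Γ ℍ //
        ∃ τ : ℍ, Quotient.mk (MulAction.orbitRel Γ ℍ) τ = y ∧ Ψ τ - w₀ ∈ Λ} ∧
      ∀ᶠ w in 𝓝 w₀,
        Nat.card {y : MulAction.orbitRel.Quotient Γ ℍ //
          ∃ τ : ℍ, Quotient.mk (MulAction.orbitRel Γ ℍ) τ = y ∧ Ψ τ - w ∈ Λ} =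
        Nat.card {y : MulAction.orbitRel.Quotient Γ ℍ //
          ∃ τ : ℍ, Quotient.mk (MulAction.orbitRel Γ ℍ) τ = y ∧ Ψ τ - w₀ ∈ Λ} := by
    intro w₀ hw₀
    have hw₀' : ∀ x ∈ F₁, w₀ - x ∉ Λ := fun x hx h ↦ hw₀ ⟨x, hx, h⟩
    have hred : ∀ᶠ w in 𝓝 w₀, ∀ τ : ℍ, Ψ τ - w ∈ Λ → ∃ γ ∈ Γ, γ • τ ∈ K :=
      Filter.Eventually.of_forall fun w τ _ ↦ hKcov τ
    refine finite_and_eventually_natCard_fiberOrbits_eq hΨc hΛc hr hrΛ hΨΓ hK hred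
      fun τ hτK hτ ↦ hloc τ ?_
    intro hhτ
    apply hw₀' (Ψ τ) ⟨τ, ⟨hhτ, hτK⟩, rfl⟩
    simpa using Λ.neg_mem hτ
  -- the count as a function, constant on the connected set `S'ᶜ`
  set n : ℂ → ℕ := fun w ↦ Nat.card {y : MulAction.orbitRel.Quotient Γ ℍ //
      ∃ τ : ℍ, Quotient.mk (MulAction.orbitRel Γ ℍ) τ = y ∧ Ψ τ - w ∈ Λ} with hn
  have hconst : ∀ w ∈ S'ᶜ, ∀ w' ∈ S'ᶜ, n w = n w' := by
    have hconn : IsConnected S'ᶜ :=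
      hS'count.isConnected_compl_of_one_lt_rank (by rw [Complex.rank_real_complex]; norm_num)
    haveI := Subtype.preconnectedSpace hconn.isPreconnected
    have hlc : IsLocallyConstant (fun x : ↥(S'ᶜ) ↦ n x) := by
      refine (IsLocallyConstant.iff_eventually_eq _).mpr fun x ↦ ?_
      exact continuous_subtype_val.continuousAt.eventually (hmain x.1 x.2).2
    intro w hw w' hw'
    have h := congr_fun (hlc.eq_const ⟨w, hw⟩) ⟨w', hw'⟩
    simp only [const_apply] at h
    exact h.symm
  -- a base point `w₁ ∉ S'` in the image of `Ψ`: there `n w₁ ≥ 1`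
  obtain ⟨τ₁, hτ₁⟩ : ∃ τ₁ : ℍ, h τ₁ ≠ 0 := by
    by_contra hc
    simp only [not_exists, not_not] at hc
    exact hh (funext hc)
  obtain ⟨w₁, hw₁S, σ₁, -, hσ₁⟩ : (S'ᶜ ∩ Ψ '' univ).Nonempty :=
    (hS'count.dense_compl ℝ).inter_nhds_nonempty ((hloc τ₁ hτ₁).2 (image_mem_map univ_mem))
  have hd : 0 < n w₁ := by
    haveI := (hmain w₁ hw₁S).1
    refine Nat.card_pos_iff.mpr ⟨⟨⟨Quotient.mk _ σ₁, σ₁, rfl, ?_⟩⟩, inferInstance⟩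
    simp [hσ₁, Λ.zero_mem]
  -- conclusion
  refine ⟨n w₁, hd, (hF₁fin.image (QuotientAddGroup.mk : ℂ → ℂ ⧸ Λ)).subset ?_⟩
  intro P hP
  by_contra hPF
  obtain ⟨w, rfl⟩ := QuotientAddGroup.mk_surjective P
  have hwS : w ∈ S'ᶜ := by
    rintro ⟨x, hx, hwx⟩
    exact hPF ⟨x, hx, (QuotientAddGroup.eq_iff_sub_mem.mpr hwx).symm⟩
  apply hP
  rw [← hconst w hwS w₁ hw₁S, hn]
  refine Nat.card_congr (Equiv.subtypeEquivRight fun y ↦ ?_)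
  simp only [QuotientAddGroup.eq_iff_sub_mem]

end Summit.BirchSwinnertonDyer.BirchSwinnertonDyer.Theorems.CartanCover.MapDegree

end
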